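import Mathlib.Algebra.Group.Prod
import Mathlib.Data.Fin.Basic
import Mathlib.Data.Finset.Prod

/-!
# Lexicographic products of ladders — explicit / elementary route (siege attempt k10)

Item `stmt-MatrixMultiplication-14308` (`FourierTwoFamiliesModP.PrimeTwoFamilies`, CKSU 2005 Conj. 4.7 with
prime cyclic hosts), line `Sketch`, registered stub `isLadder_lexProd`.

A LADDER in an additive commutative group `G` is an ordered family `(X c, Y c)_{c < r}` of finite subsets
with

* (directness, `hW`) every class is direct: for `x, x' ∈ X c`, `y, y' ∈ Y c`,
  `(x - x') + (y - y') = 0` forces `x = x'` and `y = y'`;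
* (one-directional separation, `hL`) for `p < q` the lower cross differences `y' - x'`
  (`x' ∈ X p`, `y' ∈ Y q`) avoid every diagonal difference `y - x` (`x ∈ X c`, `y ∈ Y c`).

The stub: from a ladder indexed by `Fin r₁` in `G₁` and a ladder indexed by `Fin r₂` in `G₂`, the
`Fin (r₁ * r₂)`-indexed family `c ↦ (X₁ c.divNat ×ˢ X₂ c.modNat, Y₁ c.divNat ×ˢ Y₂ c.modNat)` in
`G₁ × G₂` is again a ladder (so class number, co-volume and host size multiply).

This file makes the three elementary ingredients EXPLICIT, each as a named lemma proved from first
principles (no decision procedure: no `omega`, no `decide`, no `simp` search):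

1. **Arithmetic of the index set** (`mod_lt_mod_of_lt_of_div_le`, `div_lt_div_or_mod_lt_mod`,
   `divNat_lt_or_modNat_lt`).  The only property of the digit maps `(divNat, modNat)` that the ladder
   needs is ONE-SIDED: `p < q → p.divNat < q.divNat ∨ p.modNat < q.modNat`.  It is read off the
   Euclidean identity `P = R * (P / R) + P % R` by one monotonicity and one cancellation:
   if the quotients do not increase then `R * (Q / R) + P % R ≤ P < Q = R * (Q / R) + Q % R`.
2. **Coordinates in `G₁ × G₂`** (`direct_prod`, `sub_ne_sub_of_fst`, `sub_ne_sub_of_snd`).  Directness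
   of a product class `(S₁ ×ˢ S₂, T₁ ×ˢ T₂)` is directness of its two factors, because the equation
   `(x - x') + (y - y') = 0` holds coordinatewise (definitionally); and two differences in `G₁ × G₂`
   differ as soon as they differ in one coordinate.
3. **Re-indexing** (`sep_prod_comap`).  For ANY pair of index maps `f : ι → κ₁`, `g : ι → κ₂` carrying
   `p < q` into "`f p < f q` or `g p < g q`", the coordinatewise product of a `κ₁`-ladder and a
   `κ₂`-ladder re-indexed along `(f, g)` is separated over `ι`: separate in the coordinate that `(f, g)`
   names.  The lexicographic product is the instance `(f, g) = (divNat, modNat)` supplied by 1.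

`isLadder_lexProd` (the registered signature, verbatim) is the composite 2 + 3 ∘ 1, in term mode.

Design: Mathlib-only, minimal imports (`Mathlib.Algebra.Group.Prod` for the product group,
`Mathlib.Data.Fin.Basic` for `Fin.divNat` / `Fin.modNat`, `Mathlib.Data.Finset.Prod` for `×ˢ`); no new
definitions (the ladder clauses stay inlined exactly as in the route's registered stubs).  Independent
proofs of the same registered stub by sibling attempts live in their own files and namespaces
(`…PrimeTwoFamilies.LadderLift.isLadder_lexProd`, `…LadderLexProdFiniteCore.isLadder_lexProd`, …); this
file shares no code with them.
-/

-- single-conjunct summit: the mandated namespace repeats `MatrixMultiplication` (summit = sub-problem).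
set_option linter.dupNamespace false

namespace Summit.MatrixMultiplication.MatrixMultiplication.Theorems.PrimeTwoFamilies.LadderLexProdK10

/-! ### 1. Arithmetic of the index set: `Fin (r₁ * r₂)` read through `(divNat, modNat)` -/

/-- **Remainders increase when quotients do not.**  If `P < Q` but `Q / R ≤ P / R`, then
`P % R < Q % R`: from the Euclidean identities, `R * (Q / R) + P % R ≤ R * (P / R) + P % R = P < Q =
R * (Q / R) + Q % R`, and the common summand `R * (Q / R)` cancels.  (Valid for `R = 0` as well, where
both quotients vanish and the remainders are `P`, `Q` themselves.) -/
theorem mod_lt_mod_of_lt_of_div_le {P Q R : ℕ} (h : P < Q) (hd : Q / R ≤ P / R) : P % R < Q % R :=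
  Nat.lt_of_add_lt_add_left <|
    calc R * (Q / R) + P % R ≤ R * (P / R) + P % R := Nat.add_le_add_right (Nat.mul_le_mul_left R hd) _
      _ = P := Nat.div_add_mod P R
      _ < Q := h
      _ = R * (Q / R) + Q % R := (Nat.div_add_mod Q R).symm

/-- **One-sided digit comparison.**  If `P < Q` then, for every modulus `R`, either the quotients compare
strictly, `P / R < Q / R`, or the remainders do, `P % R < Q % R`. -/
theorem div_lt_div_or_mod_lt_mod {P Q : ℕ} (R : ℕ) (h : P < Q) : P / R < Q / R ∨ P % R < Q % R :=
  (Nat.lt_or_ge (P / R) (Q / R)).imp_right (mod_lt_mod_of_lt_of_div_le h)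

/-- **The index set.**  For `p < q` in `Fin (m * n)`, either `p.divNat < q.divNat` or
`p.modNat < q.modNat` — the one property of the digit maps that the ladder product uses.  (The order
of `Fin _` is the order of the underlying naturals, and `p.divNat`, `p.modNat` have underlying naturals
`p / n`, `p % n` by definition, so this IS `div_lt_div_or_mod_lt_mod` for the modulus `n`.) -/
theorem divNat_lt_or_modNat_lt {m n : ℕ} {p q : Fin (m * n)} (h : p < q) :
    p.divNat < q.divNat ∨ p.modNat < q.modNat :=
  show (p : ℕ) / n < q / n ∨ (p : ℕ) % n < q % n from div_lt_div_or_mod_lt_mod n (Fin.lt_def.1 h)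

/-! ### 2. Coordinates in `G₁ × G₂` -/

variable {G₁ G₂ : Type*} [AddCommGroup G₁] [AddCommGroup G₂]

/-- First coordinate of the directness expression (definitional). -/
theorem fst_sub_add_sub (x x' y y' : G₁ × G₂) :
    ((x - x') + (y - y')).1 = (x.1 - x'.1) + (y.1 - y'.1) := rfl

/-- Second coordinate of the directness expression (definitional). -/
theorem snd_sub_add_sub (x x' y y' : G₁ × G₂) :
    ((x - x') + (y - y')).2 = (x.2 - x'.2) + (y.2 - y'.2) := rfl

/-- **Directness of a product class is directness of its factors.**  If `(S₁, T₁)` is a direct pair in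
`G₁` and `(S₂, T₂)` is a direct pair in `G₂`, then `(S₁ ×ˢ S₂, T₁ ×ˢ T₂)` is a direct pair in `G₁ × G₂`:
the equation `(x - x') + (y - y') = 0` holds in each coordinate, the factors give equality of the
coordinates, and points of a product are determined by their coordinates. -/
theorem direct_prod {S₁ T₁ : Finset G₁} {S₂ T₂ : Finset G₂}
    (h₁ : ∀ x ∈ S₁, ∀ x' ∈ S₁, ∀ y ∈ T₁, ∀ y' ∈ T₁, (x - x') + (y - y') = 0 → x = x' ∧ y = y')
    (h₂ : ∀ x ∈ S₂, ∀ x' ∈ S₂, ∀ y ∈ T₂, ∀ y' ∈ T₂, (x - x') + (y - y') = 0 → x = x' ∧ y = y') :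
    ∀ x ∈ S₁ ×ˢ S₂, ∀ x' ∈ S₁ ×ˢ S₂, ∀ y ∈ T₁ ×ˢ T₂, ∀ y' ∈ T₁ ×ˢ T₂,
      (x - x') + (y - y') = 0 → x = x' ∧ y = y' := by
  intro x hx x' hx' y hy y' hy' h
  rw [Finset.mem_product] at hx hx' hy hy'
  have e₁ : (x.1 - x'.1) + (y.1 - y'.1) = 0 := (fst_sub_add_sub x x' y y').symm.trans (congrArg Prod.fst h)
  have e₂ : (x.2 - x'.2) + (y.2 - y'.2) = 0 := (snd_sub_add_sub x x' y y').symm.trans (congrArg Prod.snd h)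
  obtain ⟨hx₁, hy₁⟩ := h₁ x.1 hx.1 x'.1 hx'.1 y.1 hy.1 y'.1 hy'.1 e₁
  obtain ⟨hx₂, hy₂⟩ := h₂ x.2 hx.2 x'.2 hx'.2 y.2 hy.2 y'.2 hy'.2 e₂
  exact ⟨Prod.ext hx₁ hx₂, Prod.ext hy₁ hy₂⟩

/-- Two differences in `G₁ × G₂` that differ in the FIRST coordinate differ. -/
theorem sub_ne_sub_of_fst {x y x' y' : G₁ × G₂} (h : y.1 - x.1 ≠ y'.1 - x'.1) : y - x ≠ y' - x' :=
  fun e => h (congrArg Prod.fst e)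

/-- Two differences in `G₁ × G₂` that differ in the SECOND coordinate differ. -/
theorem sub_ne_sub_of_snd {x y x' y' : G₁ × G₂} (h : y.2 - x.2 ≠ y'.2 - x'.2) : y - x ≠ y' - x' :=
  fun e => h (congrArg Prod.snd e)

/-! ### 3. Re-indexing: separation of a coordinatewise product along a pair of index maps -/

/-- **Separation transfers along any pair of index maps that is strictly increasing in SOME
coordinate.**  Let `(X₁ c, Y₁ c)_{c : κ₁}` be one-directionally separated in `G₁` and
`(X₂ c, Y₂ c)_{c : κ₂}` in `G₂`, and let `f : ι → κ₁`, `g : ι → κ₂` satisfy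
`p < q → f p < f q ∨ g p < g q`.  Then the `ι`-indexed product family
`c ↦ (X₁ (f c) ×ˢ X₂ (g c), Y₁ (f c) ×ˢ Y₂ (g c))` is one-directionally separated in `G₁ × G₂`:
for `p < q` a coincidence `y - x = y' - x'` would hold in both coordinates, contradicting the
separation of the factor named by `(f, g)`. -/
theorem sep_prod_comap {κ₁ κ₂ ι : Type*} [LT κ₁] [LT κ₂] [LT ι]
    (X₁ Y₁ : κ₁ → Finset G₁) (X₂ Y₂ : κ₂ → Finset G₂) (f : ι → κ₁) (g : ι → κ₂)
    (hfg : ∀ p q : ι, p < q → f p < f q ∨ g p < g q)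
    (hL₁ : ∀ c p q : κ₁, p < q → ∀ x ∈ X₁ c, ∀ y ∈ Y₁ c, ∀ x' ∈ X₁ p, ∀ y' ∈ Y₁ q,
      y - x ≠ y' - x')
    (hL₂ : ∀ c p q : κ₂, p < q → ∀ x ∈ X₂ c, ∀ y ∈ Y₂ c, ∀ x' ∈ X₂ p, ∀ y' ∈ Y₂ q,
      y - x ≠ y' - x') :
    ∀ c p q : ι, p < q →
      ∀ x ∈ X₁ (f c) ×ˢ X₂ (g c), ∀ y ∈ Y₁ (f c) ×ˢ Y₂ (g c),
      ∀ x' ∈ X₁ (f p) ×ˢ X₂ (g p), ∀ y' ∈ Y₁ (f q) ×ˢ Y₂ (g q), y - x ≠ y' - x' := by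
  intro c p q hpq x hx y hy x' hx' y' hy'
  rw [Finset.mem_product] at hx hy hx' hy'
  rcases hfg p q hpq with h | h
  · exact sub_ne_sub_of_fst (hL₁ (f c) (f p) (f q) h x.1 hx.1 y.1 hy.1 x'.1 hx'.1 y'.1 hy'.1)
  · exact sub_ne_sub_of_snd (hL₂ (g c) (g p) (g q) h x.2 hx.2 y.2 hy.2 x'.2 hx'.2 y'.2 hy'.2)

/-! ### The registered stub -/

/-- **Lexicographic products of ladders are ladders** (registered stub `isLadder_lexProd`, line
`Sketch` of crux `PrimeTwoFamilies`).  If `(X₁ c, Y₁ c)_{c < r₁}` is a ladder in `G₁` (each class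
direct, `hW₁`; one-directionally separated, `hL₁`) and `(X₂ c, Y₂ c)_{c < r₂}` is a ladder in `G₂`
(`hW₂`, `hL₂`), then the family indexed by `c : Fin (r₁ * r₂)` with classes
`X₁ c.divNat ×ˢ X₂ c.modNat` and `Y₁ c.divNat ×ˢ Y₂ c.modNat` in `G₁ × G₂` is a ladder: every class
is direct (`direct_prod`, coordinatewise) and the family is one-directionally separated
(`sep_prod_comap` along `(divNat, modNat)`, which is strictly increasing in some coordinate by
`divNat_lt_or_modNat_lt`). -/
theorem isLadder_lexProd {G₁ G₂ : Type*} [AddCommGroup G₁] [AddCommGroup G₂] {r₁ r₂ : ℕ}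
    (X₁ Y₁ : Fin r₁ → Finset G₁) (X₂ Y₂ : Fin r₂ → Finset G₂)
    (hW₁ : ∀ c : Fin r₁, ∀ x ∈ X₁ c, ∀ x' ∈ X₁ c, ∀ y ∈ Y₁ c, ∀ y' ∈ Y₁ c,
      (x - x') + (y - y') = 0 → x = x' ∧ y = y')
    (hL₁ : ∀ c p q : Fin r₁, p < q → ∀ x ∈ X₁ c, ∀ y ∈ Y₁ c, ∀ x' ∈ X₁ p, ∀ y' ∈ Y₁ q,
      y - x ≠ y' - x')
    (hW₂ : ∀ c : Fin r₂, ∀ x ∈ X₂ c, ∀ x' ∈ X₂ c, ∀ y ∈ Y₂ c, ∀ y' ∈ Y₂ c,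
      (x - x') + (y - y') = 0 → x = x' ∧ y = y')
    (hL₂ : ∀ c p q : Fin r₂, p < q → ∀ x ∈ X₂ c, ∀ y ∈ Y₂ c, ∀ x' ∈ X₂ p, ∀ y' ∈ Y₂ q,
      y - x ≠ y' - x') :
    (∀ c : Fin (r₁ * r₂), ∀ x ∈ X₁ c.divNat ×ˢ X₂ c.modNat, ∀ x' ∈ X₁ c.divNat ×ˢ X₂ c.modNat,
        ∀ y ∈ Y₁ c.divNat ×ˢ Y₂ c.modNat, ∀ y' ∈ Y₁ c.divNat ×ˢ Y₂ c.modNat,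
        (x - x') + (y - y') = 0 → x = x' ∧ y = y') ∧
    (∀ c p q : Fin (r₁ * r₂), p < q →
        ∀ x ∈ X₁ c.divNat ×ˢ X₂ c.modNat, ∀ y ∈ Y₁ c.divNat ×ˢ Y₂ c.modNat,
        ∀ x' ∈ X₁ p.divNat ×ˢ X₂ p.modNat, ∀ y' ∈ Y₁ q.divNat ×ˢ Y₂ q.modNat,
        y - x ≠ y' - x') :=
  ⟨fun c => direct_prod (hW₁ c.divNat) (hW₂ c.modNat),
    sep_prod_comap X₁ Y₁ X₂ Y₂ Fin.divNat Fin.modNat (fun _ _ h => divNat_lt_or_modNat_lt h) hL₁ hL₂⟩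

end Summit.MatrixMultiplication.MatrixMultiplication.Theorems.PrimeTwoFamilies.LadderLexProdK10
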